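import Summits.ResolutionOfSingularities.ResolutionOfSingularities.Theorems.FrobeniusClosingSteerCleaningOptimalOfIsolated
import HarnessLib

/-!
# Crux `Steer` (stmt-ResolutionOfSingularities-16345), chain W4.1, §σ2.26 v2: **`CleaningExact` — along a K♭ step the stage-0 cleaning
# has order EXACTLY `p·e₀`** (both conjuncts; Theses-free, def-free)

OURS (campaign `res-hironaka`, rung L ★L-G4, slot W4.1; seat res-D-pv-011; the (C)-leaf material for res-L0-w41-strat-2's §σ2.26 v2
`CleaningExact p c` (HOME/STATUS 2026-08-27T10:42:51Z: «2 < c → window + exc + hmult₁ + hiso₁ → f₀ − g₀^p ∈ 𝔪₀^(p e₀) ∧ ∀ h,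
f₀ − h^p ∉ 𝔪₀^(p e₀+1) — pv-011's brick + Q2»); replaces the role of no printed item and is NOT a statement of the manuscript under
review [claim: Hironaka2017, status: under-review]; AI-produced, weaker than expert review).

* `mem_pow_of_quadraticTransform` — Q2 in the `IsQuadraticTransform` currency: for a quadratic transform `S₀ → S₁` of a REGULAR `S₀`
  with `𝔪_{S₀}·S₁ = (x₀)`, an element `y ∈ S₀` with `y = x₀^n · a`, `a ∈ S₁`, lies in `𝔪_{S₀}^n` (`x₀^n S₁ ∩ S₀ = 𝔪₀^n`; Chevalley valuation
  ring dominating `S₁` + res-L0-w41-stub-4's Q2 `QuadraticStep.mul_pow_mem_maximalIdeal_pow`). [cite: ZariskiSamuel1960, Ch. VIII §1 Thm. 1]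
* `sub_pow_mem_pow_of_law` — the FIRST conjunct: the law `f₁ · x₀^(p e₀) = f₀ − g₀^p` gives `f₀ − g₀^p ∈ 𝔪_{S₀}^(p e₀)`.
* `cleaningExact_of_quadraticTransform` — BOTH conjuncts over the K♭ step binders (first: any `c`; second: `2 < c`, multiplicity `p` and
  isolated torsor at stage 1, via `CleaningOptimal.cleaning_optimal_of_quadraticTransform`, p524687).
[cite: Cutkosky2014, §2.1–2.2] [cite: Matsumura1987, Thm. 14.2, Thm. 19.4] [folklore]
-/

noncomputable section

-- `Summit.<S>.<S>.…` duplicates the summit name by design (single-problem summit).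
set_option linter.dupNamespace false

open Polynomial IsLocalRing

namespace Summit.ResolutionOfSingularities.ResolutionOfSingularities.Theorems.SwitchingDichotomy.CleaningOptimal

open Literature.AlgebraicGeometry.Resolution

variable {L : Type} [Field L]

/-- **Q2 for an abstract quadratic transform**: `S₀ → S₁` a quadratic transform of a regular local `S₀ ⊆ L`, `𝔪_{S₀}·S₁ = (x₀)`;
if `y ∈ S₀` equals `x₀^n · a` with `a ∈ S₁` then `y ∈ 𝔪_{S₀}^n`. [cite: ZariskiSamuel1960, Ch. VIII §1 Thm. 1] [cite: Cutkosky2014, §2.2] -/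
theorem mem_pow_of_quadraticTransform {S₀ S₁ : Subring L} [IsLocalRing S₀] [IsLocalRing S₁]
    (hreg₀ : IsRegularLocalRing S₀) (hQT : IsQuadraticTransform S₀ S₁) (h₀₁ : S₀ ≤ S₁) (x₀ : S₁)
    (hspan : Ideal.span ((fun y : S₀ => (⟨(y : L), h₀₁ y.2⟩ : S₁)) '' (maximalIdeal S₀ : Set S₀)) = Ideal.span {x₀})
    {n : ℕ} {y : S₀} {a : S₁} (hy : (y : L) = (x₀ : L) ^ n * a) : y ∈ maximalIdeal S₀ ^ n := by
  classical
  haveI := hreg₀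
  -- ### Chevalley: a valuation ring `W` dominating `S₁`; the transform is the local blowing up along `W`
  obtain ⟨W, hW⟩ := (LocalSubring.mk S₁).exists_le_valuationSubring
  haveI : IsLocalRing W.toSubring := inferInstanceAs (IsLocalRing W)
  have hSW : SubringDominates S₁ W.toSubring := (subringDominates_iff S₁ W.toSubring).mpr hW
  have hdom : SubringDominates S₀ S₁ := hQT.dominates
  have hdom₀ : SubringDominates S₀ W.toSubring := hdom.trans hSW
  have hA : IsQuadraticTransformAlong W S₀ S₁ := hQT.along ⟨inferInstance, IsNoetherian.noetherian _⟩ hSW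
  obtain ⟨_, x, hxm, hx0, hmax, hS₁⟩ := hA.exists_eq_locAtCentre
  have hx0K : (x : L) ≠ 0 := fun h => hx0 (Subtype.ext h)
  have hvx : W.valuation (x : L) < 1 := ((subringDominates_valuationSubring_iff hdom₀.1).mp hdom₀ x).mp hxm
  -- ### `x₀ = x · b` with `b ∈ S₁`
  have hBS : blowupRing S₀ (x : L) ≤ S₁ := by
    rw [hS₁]
    exact le_locAtCentre _ W
  have hx₀X : x₀ ∈ Ideal.span {(⟨(x : L), h₀₁ x.2⟩ : S₁)} := by
    have hle : Ideal.span ((fun y : S₀ => (⟨(y : L), h₀₁ y.2⟩ : S₁)) '' (maximalIdeal S₀ : Set S₀)) ≤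
        Ideal.span {(⟨(x : L), h₀₁ x.2⟩ : S₁)} := by
      rw [Ideal.span_le]
      rintro _ ⟨z, hz, rfl⟩
      refine Ideal.mem_span_singleton'.mpr ⟨⟨(z : L) / x, hBS (div_mem_blowupRing (x : L) hz)⟩, ?_⟩
      exact Subtype.ext (by
        change (z : L) / x * x = z
        rw [div_mul_cancel₀ _ hx0K])
    rw [hspan] at hle
    exact hle (Ideal.mem_span_singleton_self x₀)
  obtain ⟨b, hb⟩ := Ideal.mem_span_singleton'.mp hx₀X
  have hbK : (x₀ : L) = (b : L) * x := by
    have := congrArg Subtype.val hb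
    simpa using this.symm
  -- ### Q2 along `W` for the least-value parameter `x`
  have hxa : (x : L) ^ n * ((b : L) ^ n * a) ∈ S₀ := by
    have : (x : L) ^ n * ((b : L) ^ n * a) = (y : L) := by rw [hy, hbK]; ring
    rw [this]
    exact y.2
  have hmem := QuadraticStep.mul_pow_mem_maximalIdeal_pow hA hdom₀ x.2 hvx
    ((S₁).mul_mem (S₁.pow_mem b.2 n) a.2) n hxa
  have hyeq : (⟨(x : L) ^ n * ((b : L) ^ n * a), hxa⟩ : S₀) = y :=
    Subtype.ext (by change (x : L) ^ n * ((b : L) ^ n * a) = y; rw [hy, hbK]; ring)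
  rwa [hyeq] at hmem

/-- **First conjunct of `CleaningExact`**: the K♭ law `f₁ · x₀^(p·e₀) = f₀ − g₀^p` over a quadratic transform of a regular `S₀` gives
`f₀ − g₀^p ∈ 𝔪_{S₀}^(p·e₀)`. [folklore] -/
theorem sub_pow_mem_pow_of_law (p : ℕ) {S₀ S₁ : Subring L} [IsLocalRing S₀] [IsLocalRing S₁]
    (hreg₀ : IsRegularLocalRing S₀) (hQT : IsQuadraticTransform S₀ S₁) (h₀₁ : S₀ ≤ S₁)
    (f₀ g₀ : S₀) (f₁ x₀ : S₁) (e₀ : ℕ)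
    (hspan : Ideal.span ((fun y : S₀ => (⟨(y : L), h₀₁ y.2⟩ : S₁)) '' (maximalIdeal S₀ : Set S₀)) = Ideal.span {x₀})
    (hlaw : ((f₁ : S₁) : L) * ((x₀ : S₁) : L) ^ (p * e₀) = ((f₀ : S₀) : L) - ((g₀ : S₀) : L) ^ p) :
    f₀ - g₀ ^ p ∈ maximalIdeal S₀ ^ (p * e₀) := by
  refine mem_pow_of_quadraticTransform hreg₀ hQT h₀₁ x₀ hspan (a := f₁) ?_
  push_cast
  rw [← hlaw, mul_comm]

variable (p : ℕ) [Fact p.Prime] [CharP L p]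

/-- **`CleaningExact` over the K♭ step binders** (res-L0-w41-strat-2 §σ2.26 v2 (C)): along one cleaning-and-stripping step in
codimension `c ≥ 3` whose next member has multiplicity `p` and isolated torsor singularity, the stage-0 cleaning has order EXACTLY `p·e₀`:
`f₀ − g₀^p ∈ 𝔪₀^(p e₀)` and `∀ h, f₀ − h^p ∉ 𝔪₀^(p e₀ + 1)`. [cite: Matsumura1987, Thm. 14.2, Thm. 19.4] [cite: Cutkosky2014, §2.1] [folklore] -/
theorem cleaningExact_of_quadraticTransform (S₀ S₁ : Subring L) [IsLocalRing S₀] [IsLocalRing S₁] (h₀₁ : S₀ ≤ S₁)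
    (f₀ g₀ : S₀) (f₁ x₀ : S₁) (e₀ : ℕ) {c : ℕ} (hc : 2 < c)
    (hreg₀ : IsRegularLocalRing S₀) (hreg₁ : IsRegularLocalRing S₁) (hdim₁ : ringKrullDim S₁ = c)
    (hQT : IsQuadraticTransform S₀ S₁)
    (hspan : Ideal.span ((fun y : S₀ => (⟨(y : L), h₀₁ y.2⟩ : S₁)) '' (maximalIdeal S₀ : Set S₀)) = Ideal.span {x₀})
    (hlaw : ((f₁ : S₁) : L) * ((x₀ : S₁) : L) ^ (p * e₀) = ((f₀ : S₀) : L) - ((g₀ : S₀) : L) ^ p)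
    (hmult₁ : ∃ h : S₁, f₁ - h ^ p ∈ maximalIdeal S₁ ^ p)
    (hiso₁ : ∀ (P : Ideal (AdjoinRoot ((X : (S₁)[X]) ^ p - C f₁))) [P.IsPrime],
      (∃ Q : Ideal (AdjoinRoot ((X : (S₁)[X]) ^ p - C f₁)), Q.IsPrime ∧ P < Q) →
      IsRegularLocalRing (Localization.AtPrime P)) :
    f₀ - g₀ ^ p ∈ maximalIdeal S₀ ^ (p * e₀) ∧ ∀ h : S₀, f₀ - h ^ p ∉ maximalIdeal S₀ ^ (p * e₀ + 1) :=
  ⟨sub_pow_mem_pow_of_law p hreg₀ hQT h₀₁ f₀ g₀ f₁ x₀ e₀ hspan hlaw,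
    cleaning_optimal_of_quadraticTransform p S₀ S₁ h₀₁ f₀ g₀ f₁ x₀ e₀ hc hreg₀ hreg₁ hdim₁ hQT hspan hlaw hmult₁ hiso₁⟩

end Summit.ResolutionOfSingularities.ResolutionOfSingularities.Theorems.SwitchingDichotomy.CleaningOptimal

end
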